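import Literature.IUT.LogVolume.Corollary22Statement
import Literature.NumberTheory.DiophantineGeometry.GenEllNorthcott
import HarnessLib

/-!
# [IUTchIV] Corollary 2.2 (ii): the CM locus `j ∈ {0, 1728}` of the `λ`-line has finitely many points

Mochizuki, *Inter-universal Teichmüller theory IV*, RIMS manuscript (Apr. 2020; = PRIMS **57** (2021)),
Cor. 2.2 (ii), p. 42: the exceptional set `Exc_d` "contains all points corresponding to elliptic curves
that admit automorphisms of order `> 2`" — i.e. (proof, p. 43) the four points `j ∈ {0, 1728}` excluded
"in order to apply Proposition 1.8"; S3's `Cor22.PartII` records this as the membership clause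
`jInv P.x = 0 ∨ jInv P.x = 1728 → P ∈ Exc`, with `Exc` required to have finitely many points in the sense
of [GenEll] Ex. 1.3 (i) (`HasFinitelyManyPoints`: finitely many minimal polynomials).

PROVED here (classical, proof-only, no definitions): on the `λ`-line, `j(λ) = 2^8(λ²−λ+1)³/(λ²(λ−1)²)`
vanishes iff `λ² − λ + 1 = 0` (or `λ ∈ {0,1}`, where the tree's `jInv` takes its junk value `0`), and
`j(λ) = 1728` iff `(λ+1)(λ−2)(2λ−1) = 0`, by the identity
`4(λ²−λ+1)³ − 27λ²(λ−1)² = (λ+1)²(λ−2)²(2λ−1)²`; hence the minimal polynomial of any presented point with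
`j ∈ {0, 1728}` is a monic irreducible factor of the fixed polynomial
`G = X(X−1)(X+1)(X−2)(2X−1)(X²−X+1) ∈ ℚ[X]`, and there are finitely many of those
(`UniqueFactorizationMonoid.normalizedFactors`).  So the CM clause of `Cor22.PartII` costs nothing:
`hasFinitelyManyPoints_jInv_cm`.  Nothing here takes a side on [IUTchIII] Cor. 3.12.
-/

noncomputable section

namespace Literature.IUT.LogVolume

namespace Cor22

open Polynomial Literature.NumberTheory.DiophantineGeometry.GenEll

/-- The polynomial `G = X(X−1)(X+1)(X−2)(2X−1)(X²−X+1)` vanishes at every `λ` with `j(λ) ∈ {0, 1728}`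
(including the junk points `λ ∈ {0,1}` of `jInv`). [folklore] -/
private theorem aeval_G_eq_zero {F : Type*} [Field F] [CharZero F] (t : F)
    (h : jInv t = 0 ∨ jInv t = 1728) :
    aeval t (X * (X - 1) * (X + 1) * (X - 2) * (2 * X - 1) * (X ^ 2 - X + 1) : ℚ[X]) = 0 := by
  have hG : aeval t (X * (X - 1) * (X + 1) * (X - 2) * (2 * X - 1) * (X ^ 2 - X + 1) : ℚ[X]) =
      t * (t - 1) * (t + 1) * (t - 2) * (2 * t - 1) * (t ^ 2 - t + 1) := by
    simp only [map_mul, map_sub, map_add, map_pow, aeval_X, map_one, map_ofNat]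
  rw [hG]
  rcases h with h0 | h1728
  · -- `j = 0`: numerator or denominator vanishes
    unfold jInv at h0
    rcases div_eq_zero_iff.mp h0 with hnum | hden
    · have h3 : (t ^ 2 - t + 1) ^ 3 = 0 := by
        have : (2 : F) ^ 8 ≠ 0 := pow_ne_zero 8 (by norm_num)
        exact (mul_eq_zero.mp hnum).resolve_left this
      have h1 : t ^ 2 - t + 1 = 0 := pow_eq_zero_iff (by norm_num) |>.mp h3
      rw [h1]; ring
    · rcases mul_eq_zero.mp hden with ht | ht
      · have : t = 0 := pow_eq_zero_iff (by norm_num) |>.mp ht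
        rw [this]; ring
      · have : t - 1 = 0 := pow_eq_zero_iff (by norm_num) |>.mp ht
        rw [this]; ring
  · -- `j = 1728`: the denominator is nonzero and `(λ+1)(λ−2)(2λ−1) = 0`
    unfold jInv at h1728
    have hden : t ^ 2 * (t - 1) ^ 2 ≠ 0 := by
      intro hden
      rw [hden, div_zero] at h1728
      norm_num at h1728
    rw [div_eq_iff hden] at h1728
    have hsq : ((t + 1) * (t - 2) * (2 * t - 1)) ^ 2 = 0 := by
      linear_combination (1 / 64 : F) * h1728
    have h1 : (t + 1) * (t - 2) * (2 * t - 1) = 0 := pow_eq_zero_iff (by norm_num) |>.mp hsq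
    linear_combination t * (t - 1) * (t ^ 2 - t + 1) * h1

/-- **The CM locus of the `λ`-line has finitely many points** ([IUTchIV] Cor. 2.2 (ii), p. 42: "`Exc_d` …
contains all points corresponding to elliptic curves that admit automorphisms of order `> 2`", i.e. the
points with `j ∈ {0, 1728}`): the set of presented points `P` with `jInv P.x = 0 ∨ jInv P.x = 1728` has
finitely many minimal polynomials (`HasFinitelyManyPoints`), for every degree at once.  (The tree's `jInv`
also vanishes at the cusps `λ ∈ {0,1}` by its junk value; they are harmlessly included.)
[claim: Mochizuki2012, status: disputed] -/
theorem hasFinitelyManyPoints_jInv_cm :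
    HasFinitelyManyPoints {P : NFPoint | jInv P.x = 0 ∨ jInv P.x = 1728} := by
  classical
  set G : ℚ[X] := X * (X - 1) * (X + 1) * (X - 2) * (2 * X - 1) * (X ^ 2 - X + 1) with hGdef
  have hG0 : G ≠ 0 := by
    have h2 : (2 * X - 1 : ℚ[X]) ≠ 0 := by
      intro h
      have := congrArg (fun p : ℚ[X] => p.eval 0) h
      norm_num at this
    have hq : (X ^ 2 - X + 1 : ℚ[X]) ≠ 0 := by
      intro h
      have := congrArg (fun p : ℚ[X] => p.eval 0) h
      norm_num at this
    rw [hGdef]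
    exact mul_ne_zero (mul_ne_zero (mul_ne_zero (mul_ne_zero (mul_ne_zero X_ne_zero
      (X_sub_C_ne_zero 1)) (X_add_C_ne_zero 1)) (X_sub_C_ne_zero 2)) h2) hq
  -- every minimal polynomial in question is a normalized irreducible factor of `G`
  refine ((UniqueFactorizationMonoid.normalizedFactors G).toFinset.finite_toSet).subset ?_
  rintro _ ⟨P, hP, rfl⟩
  have hint : IsIntegral ℚ P.x := Algebra.IsIntegral.isIntegral P.x
  have hdvd : NFPoint.mpoly P ∣ G := minpoly.dvd ℚ P.x (aeval_G_eq_zero P.x hP)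
  have hirr : Irreducible (NFPoint.mpoly P) := minpoly.irreducible hint
  obtain ⟨q, hq, hassoc⟩ := UniqueFactorizationMonoid.exists_mem_normalizedFactors_of_dvd hG0 hirr hdvd
  have hnorm : normalize (NFPoint.mpoly P) = NFPoint.mpoly P :=
    (minpoly.monic hint).normalize_eq_self
  have hq' : NFPoint.mpoly P = q := by
    rw [← hnorm, ← UniqueFactorizationMonoid.normalize_normalized_factor q hq]
    exact normalize_eq_normalize hassoc.dvd hassoc.symm.dvd
  simp only [Multiset.mem_toFinset, Finset.mem_coe]
  rw [hq']
  exact hq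

/-- The CM clause of `Cor22.PartII` for a given degree: the points of `U_X(ℚ̄)^{≤d}` (indeed of any set)
with `j ∈ {0, 1728}` have finitely many points. [claim: Mochizuki2012, status: disputed] -/
theorem hasFinitelyManyPoints_jInv_cm_inter (S : Set NFPoint) :
    HasFinitelyManyPoints {P : NFPoint | P ∈ S ∧ (jInv P.x = 0 ∨ jInv P.x = 1728)} :=
  hasFinitelyManyPoints_jInv_cm.mono fun _ hP => hP.2

/-- `HasFinitelyManyPoints` is stable under binary unions (finitely many minimal polynomials on each
side) — the form in which an exceptional set "small `log(q^∀)` OR CM" is assembled.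
[cite: MochizukiGenEll2010, Ex 1.3 (i) p.5] -/
theorem _root_.Literature.NumberTheory.DiophantineGeometry.GenEll.HasFinitelyManyPoints.union
    {S T : Set NFPoint} (hS : HasFinitelyManyPoints S) (hT : HasFinitelyManyPoints T) :
    HasFinitelyManyPoints (S ∪ T) := by
  unfold HasFinitelyManyPoints at *
  rw [Set.image_union]
  exact hS.union hT

end Cor22

end Literature.IUT.LogVolume

end
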